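import Summits.CriticalPhenomena.CardyFormulaZ2.Theorems.CardyComplexConeParafermionToSLESixFamiliesDiamondTurnCountGadget
import Literature.Probability.LatticeModels.MedialExplorationCornerEscape
import HarnessLib

/-!
# The gadgets at the start edge, corner-forbidden form with explicit steps
# (line `potential-darboux-picard-diamond`, S1p `stub_boundaryDartPhase`, part 1)

Crux `ParafermionToSLESixFamilies` (stmt-CriticalPhenomena-11389), line `potential-darboux-picard-diamond`, stub
`stub_boundaryDartPhase` (S1p). The escape paths of S1t (`gadget_data`, `…DiamondTurnCountGadget.lean`) enter the start
corner `(x₀, k₀)` from the outer corner `p⋆` of the face across the start edge by GADGET 1 (`p⋆ = x₀ + u_{k₀+3}`, one step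
`k₀ + 1`, offset `g = 1`) or GADGET 2 (`p⋆ = x₀ + u_{k₀+3} + u_{k₀}`, steps `k₀ + 1, k₀ + 2`, `g = 0`). For the phase
comparison ACROSS the sides of the diamond and for the WIRED first darts two refinements are needed, recorded here as
`gadget_dataC` (registered): the gadget steps `gds` are given EXPLICITLY (`[k₀+1]` or `[k₀+1, k₀+2]`, so that `walkTurns`
through the gadget is computable and `g + walkTurns a gds = (k₀ - a).val`, `add_walkTurns_gadget`), the frame bounds hold in
all four frames at once, and the turn-count theorem is stated for vertex paths whose CORNERS after the first are forbidden
(`turnCount_eq_of_cornerEscape_side`, `…cornerEscapeB_side` of `Literature/…/MedialExplorationCornerEscape.lean`), the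
vertex-forbidden form of S1t being a corollary (`cornerForbidden_of_vertexForbidden`).
-/

noncomputable section

namespace Summit.CriticalPhenomena.CardyFormulaZ2.Cruxes.ParafermionToSLESixFamilies.PotentialDarbouxPicardDiamond

open Literature.Probability Literature.Probability.LatticeModels Literature.Probability.Percolation
open Literature.Probability.LatticeModels.DiscreteDobrushin

/-- **Vertex-forbidden paths are corner-forbidden.** If the path leaves `u` along its `(j+1)`-st edge and every vertex
after `u` is forbidden (no inner face around, or on `B`), then every corner of the corner walk after the first is
forbidden. -/
theorem cornerForbidden_of_vertexForbidden {E : DiscreteDobrushin} {u : Site 2} {j : Fin 4} {ds : List (Fin 4)}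
    (hhead : ds.head? = some (j + 1))
    (hforb : ∀ v ∈ (pathVerts u ds).tail, (∀ i : Fin 4, ¬ E.IsInnerFace (faceAt v i)) ∨ v ∈ E.zdArcB) :
    ∀ d ∈ (cornerWalk u j ds).tail, ¬ E.IsInnerFace (cFace d) ∨ d.1 ∈ E.zdArcB := by
  obtain ⟨ds', rfl⟩ : ∃ ds', ds = (j + 1) :: ds' := by
    rcases ds with _ | ⟨d, ds'⟩
    · simp at hhead
    · simp only [List.head?_cons, Option.some.injEq] at hhead
      exact ⟨ds', by rw [hhead]⟩
  intro d hd
  rw [cornerWalk_cons_succ, List.tail_cons] at hd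
  have hv : d.1 ∈ (pathVerts u ((j + 1) :: ds')).tail := by
    rw [pathVerts_cons, List.tail_cons]; exact fst_mem_pathVerts hd
  rcases hforb d.1 hv with h | h
  · exact Or.inl (h d.2)
  · exact Or.inr h

/-- **Turning through the gadgets**: `g + walkTurns a gds = (k₀ - a).val` for both gadgets. -/
theorem add_walkTurns_gadget (k₀ a : Fin 4) {gds : List (Fin 4)} {g : ℤ}
    (h : (gds = [k₀ + 1] ∧ g = 1) ∨ (gds = [k₀ + 1, k₀ + 2] ∧ g = 0)) :
    g + walkTurns a gds = ((k₀ - a).val : ℕ) := by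
  have e1 : ∀ k₀ a : Fin 4, k₀ + 1 + 3 - a = k₀ - a := by decide
  have e2 : ∀ k₀ : Fin 4, ((k₀ + 2 + 3 - (k₀ + 1 + 2)).val : ℕ) = 2 := by decide
  rcases h with ⟨rfl, rfl⟩ | ⟨rfl, rfl⟩
  · simp only [walkTurns, e1]; ring
  · simp only [walkTurns, e1, e2]; push_cast; ring

/-- **The two gadgets at the start edge, corner-forbidden form with explicit steps** (registered helper of
`stub_boundaryDartPhase`). See the module docstring. -/
theorem gadget_dataC : ∀ (E : DiscreteDobrushin) (hE : E.IsZdAdmissible) (ps : Site 2), (ps = (startCorner hE).1 + cornerUnit ((startCorner hE).2 + 3) ∨ ps = (startCorner hE).1 + cornerUnit ((startCorner hE).2 + 3) + cornerUnit (startCorner hE).2) → ∃ (gds : List (Fin 4)) (g : ℤ), ((gds = [(startCorner hE).2 + 1] ∧ g = 1) ∨ (gds = [(startCorner hE).2 + 1, (startCorner hE).2 + 2] ∧ g = 0)) ∧ gds ≠ [] ∧ pathEnd ps gds = (startCorner hE).1 ∧ (∀ v ∈ pathVerts ps gds, v = ps ∨ v = (startCorner hE).1 + cornerUnit (startCorner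 hE).2) ∧ (pathVerts ps gds).Nodup ∧ (startCorner hE).1 ∉ pathVerts ps gds ∧ (∀ k : Fin 4, |xiC k (startCorner hE).1 - xiC k ps| ≤ 1 ∧ |upC k (startCorner hE).1 - upC k ps| ≤ 1) ∧ (∀ k : Fin 4, ∀ v ∈ pathVerts ps gds, |xiC k v - xiC k ps| ≤ 1 ∧ |upC k v - upC k ps| ≤ 1) ∧ (∀ (u : Site 2) (j : Fin 4) (ds : List (Fin 4)) (d : Site 2 × Fin 4) (S : ℤ), 2 ≤ ds.length → pathEnd u ds = (startCorner hE).1 → lastDir ds = lastDir gds → (∀ d' ∈ (cornerWalk u j ds).tail, ¬ E.IsInnerFace (cFace d') ∨ d'.1 ∈ E.zdArcB) → (pathVerts u ds ++ [(startCorner hE).1]).Nodup → d ∈ cornerWalk u j ds → d.2 = j + 3 → (∀ p' : Site 2 × Fin 4, E.IsInnerFace (cFace p') → sideVal j (cpos p') ≤ S) → (∀ d' ∈ cornerWalk u j ds, sideVal j (cpos d') ≤ S) → sideVal j (cpos ((startCorner hE).1, (startCorner hE).2 + 3)) ≤ S → sideVal j (cpos d) = S → ∀ (ω : BondConfig (Site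 2)) (t : ℕ), t < exitTime hE ω → cornerOrbit (E.bcBondConfig ω) (startCorner hE) t = (u, j) → turnCount (E.bcBondConfig ω) (startCorner hE) t = -4 - (walkTurns j ds + g)) := by
  intro E hE ps hps
  have cornerUnit_add_three_add_one : ∀ k : Fin 4, cornerUnit (k + 3) + cornerUnit (k + 1) = 0 := by decide
  have cornerUnit_add_add_two : ∀ k : Fin 4, cornerUnit k + cornerUnit (k + 2) = 0 := by decide
  set x₀ := (startCorner hE).1 with hx₀
  set k₀ := (startCorner hE).2 with hk₀
  rcases hps with hps | hps
  · -- GADGET 1: one step `k₀ + 1` into `x₀`, completed by the corner `(x₀, k₀ + 3)`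
    have hend : pathEnd ps [k₀ + 1] = x₀ := by
      rw [pathEnd_cons, hps, add_assoc, cornerUnit_add_three_add_one, add_zero]; rfl
    have hne : x₀ ≠ ps := by
      intro h
      have := congrArg (fun w => w - x₀) h
      simp only [hps, sub_self, add_sub_cancel_left] at this
      exact cornerUnit_ne_zero _ this.symm
    refine ⟨[k₀ + 1], 1, Or.inl ⟨rfl, rfl⟩, List.cons_ne_nil _ _, hend, ?_, ?_, ?_, ?_, ?_, ?_⟩
    · intro v hv; simp [pathVerts] at hv; exact Or.inl hv
    · simp [pathVerts]
    · simp [pathVerts]; exact hne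
    · intro k
      have := abs_frame_sub_le_one_of_step k (k₀ + 3) x₀
      rw [← hps] at this
      rw [abs_sub_comm, abs_sub_comm (upC k x₀)]; exact this
    · intro k v hv; simp [pathVerts] at hv; subst hv; simp
    · intro u j ds d S hlen hdsend hlast hforb hnodup hd hidx hI hEc hx hdS ω t ht horb
      have hds : ds ≠ [] := by rintro rfl; simp at hlen
      rw [lastDir_singleton] at hlast
      have hd' : d ∈ escapeList hE u j ds := List.mem_append_left _ hd
      have hI' : ∀ p : Site 2 × Fin 4, E.IsInnerFace (cFace p) → sideVal j (cpos p) ≤ sideVal j (cpos d) :=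
        fun p hp => hdS ▸ hI p hp
      have hE' : ∀ d' ∈ escapeList hE u j ds, sideVal j (cpos d') ≤ sideVal j (cpos d) := by
        intro d' hd'
        rw [escapeList, List.mem_append, List.mem_singleton] at hd'
        rw [hdS]
        rcases hd' with h | rfl
        · exact hEc d' h
        · exact hx
      exact turnCount_eq_of_cornerEscape_side hE hds hdsend hlast hforb hnodup hd' hidx hI' hE' ω ht horb
  · -- GADGET 2: step `k₀ + 1` onto the `B`-end, then `k₀ + 2` along the start edge into `x₀`
    have hb : ps + cornerUnit (k₀ + 1) = x₀ + cornerUnit k₀ := by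
      rw [hps, add_assoc, add_assoc, add_comm (cornerUnit k₀), ← add_assoc (cornerUnit (k₀ + 3)), cornerUnit_add_three_add_one,
        zero_add]
    have hend : pathEnd ps [k₀ + 1, k₀ + 2] = x₀ := by
      rw [pathEnd_cons, pathEnd_cons, hb, add_assoc, cornerUnit_add_add_two, add_zero]; rfl
    have hverts : pathVerts ps [k₀ + 1, k₀ + 2] = [ps, x₀ + cornerUnit k₀] := by
      rw [pathVerts_cons, pathVerts_cons, hb]; rfl
    have hne1 : x₀ ≠ ps := by
      intro h
      have := congrArg (xiC k₀) (h.trans hps)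
      simp only [xiC_add_unit0, xiC_add_unit3] at this
      omega
    have hne2 : x₀ ≠ x₀ + cornerUnit k₀ := by
      intro h
      have := congrArg (xiC k₀) h
      simp only [xiC_add_unit0] at this
      omega
    have hne3 : ps ≠ x₀ + cornerUnit k₀ := by
      intro h
      have := congrArg (upC k₀) (hps.symm.trans h)
      simp only [upC_add_unit0, upC_add_unit3] at this
      omega
    refine ⟨[k₀ + 1, k₀ + 2], 0, Or.inr ⟨rfl, rfl⟩, List.cons_ne_nil _ _, hend, ?_, ?_, ?_, ?_, ?_, ?_⟩
    · intro v hv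
      rw [hverts] at hv
      simp at hv
      exact hv
    · rw [hverts]; simp [hne3]
    · rw [hverts]; simp [hne1, hne2]
    · intro k
      have := abs_frame_sub_le_one_of_two_steps k (k₀ + 3) x₀
      rw [(fin4_escape_arith k₀).1, ← hps] at this
      rw [abs_sub_comm, abs_sub_comm (upC k x₀)]; exact this
    · intro k v hv
      rw [hverts] at hv
      simp at hv
      rcases hv with rfl | rfl
      · simp
      · rw [← hb]; exact abs_frame_sub_le_one_of_step k (k₀ + 1) ps
    · intro u j ds d S hlen hdsend hlast hforb hnodup hd hidx hI hEc _ hdS ω t ht horb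
      rw [lastDir_cons_cons, lastDir_singleton] at hlast
      have hI' : ∀ p : Site 2 × Fin 4, E.IsInnerFace (cFace p) → sideVal j (cpos p) ≤ sideVal j (cpos d) :=
        fun p hp => hdS ▸ hI p hp
      have hE' : ∀ d' ∈ cornerWalk u j ds, sideVal j (cpos d') ≤ sideVal j (cpos d) := fun d' h => hdS ▸ hEc d' h
      rw [add_zero]
      exact turnCount_eq_of_cornerEscapeB_side hE hlen hdsend hlast hforb (List.nodup_append.1 hnodup).1 hd hidx hI' hE'
        ω ht horb

end Summit.CriticalPhenomena.CardyFormulaZ2.Cruxes.ParafermionToSLESixFamilies.PotentialDarbouxPicardDiamond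

end
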